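import Summits.QuantumFields.BalabanUV.Beta.RowD1JointEndSymLetters
import Summits.QuantumFields.BalabanUV.Beta.SymmetrisedStepJets

/-!
# `BalabanUV.Beta.RowD1JointEndSymLiteral` — binder row D1: THE D1-TRIGGER's NAMED PLACEHOLDER ROOT, TYPED —
# `RowD1JointEndSym.d1Drift_JsB12Sym_of_letters_D1Tel_D1Rep : … → D1Drift Lc (JsB12Sym hLc N tabs cΛ cB) Nc μ ν`
# (the row's END `RowD1JointEndSymLetters` at the (0.4) literal `SymmetrisedStepJets.JsB12Sym` over its table record; (St)(Wt) DISCHARGED)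

HONEST FRAMING (cell charter, verbatim): «discharging BetaPertH makes Balaban's UV stability UNCONDITIONAL — a real constructive-QFT result; it is
NOT the continuum limit and NOT the Clay problem.»  HONEST DEPENDENCY: continuum YM on T⁴ ⇐ BetaPertH ∧ nine spine estimates (0/9 proved);
BetaPertH ⇐ (D1) ∧ (D4) ∧ CAP+tail; G-an2-4 gates asym, D1 and NE2/3/4.
DERIVED cell leaf (β sub-cell, BINDER-OWNERS row D1 OWNER `b2b-balaban-beta-an2`, gen 27; RULING R-D1-g27-3).  `beta/D1-TRIGGER.json` carries since cap-ref #109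
«placeholder_root_04: `Summit.QuantumFields.BalabanUV.Beta.RowD1JointEndSym.d1Drift_JsB12Sym_of_letters_D1Tel_D1Rep` — NOT TYPED (needs `JsB12Sym⁰ : def`)».
`SymmetrisedStepJets` (this gen) types `JsB12Sym⁰`∕`JsB12Sym` over the DISPLAYED table record `SymTables 3 Lc`; this file declares the placeholder under its
reserved fully-qualified name (the namespace `RowD1JointEndSym` spans files; the root file is at the 400-line cap): the row's END
`RowD1JointEndSymLetters.d1Drift_dressSymCtr_of_jetLetters_D1Tel_D1Rep` at `Js⁰ := JsB12Sym0 hLc N tabs cΛ cB`, with the translation letters (St)(Wt) SUPPLIED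
by the theorems `JsB12Sym0_S_translate` ∕ `JsB12Sym0_W_translate`.  WHAT IT DISPLAYS (= the row's binder denominator AT THE LITERAL, every one a
hypothesis, none proved anywhere): the table record `tabs` itself (an1's TABLES-SYM values with their letters), the Ward divergence letters (Sd)(Wd) of
`(JsB12Sym0 …).S ∕ .W` against `bhKStep 3 Lc j` with localised data commuting with `symEc Lc` and a parity-odd remainder, the conjugated reflection letters
(Sr-conj)(Wr-conj-c) with contacts and compensators, the cancellation `hcomp` (hSX's interface), `D1Tel` for `JsB12Sym`, `D1Rep` for the composite jets
`Jc`, the printed B5 facts `h12`∕`h126`, the window.  HONEST: a typed STATEMENT with its proof term = composition by name; root-level classes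
{hW-letters (Sd)(Wd), hR-letters, hcomp, D1Tel, D1Rep} — 0∕5 discharged; literal 0∕4; the table VALUES are not in the tree.  NOT D1, NOT `BetaPertH`, NOT
continuum, NOT Clay.  No statement of Bałaban's papers, no `[cite:]`, no `Prop` fact, no `def`.  Provenance: β sub-cell, unit beta-an2 gen 27, 2026-08-21
(v1); over `RowD1JointEndSymLetters` (p252739) and `SymmetrisedStepJets` BY NAME; no existing file touched.
-/

open Finset
open scoped BigOperators
open Literature.MathematicalPhysics.QuantumFieldTheory
open Literature.MathematicalPhysics.QuantumFieldTheory.Balaban1983to89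
open Literature.MathematicalPhysics.QuantumFieldTheory.Balaban1983to89.Beta
open Literature.MathematicalPhysics.QuantumFieldTheory.Balaban1983to89.Beta.VectorTailsLoc (fam kfam)
open Literature.MathematicalPhysics.QuantumFieldTheory.Balaban1983to89.Beta.VectorLegVolumeAdapter (MvE)
open ExpKernelCalculus (MKer Decays BiLoc comp tr tadpole shiftK)
open AffineAveraging (box toSite)
open AveragingContoursRooted (ctrOff ctrOff_mem_box)
open PolarizationSign (reflSign WardTransversal AxisReflectionCovariant)
open KernelReflection (refK)
open ResolventReflection (bref Φ)
open OneStepResolventKernel (Fib LocStencil JetData)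
open OneStepKernelFamily (KInvStep vertexOfK TbalOf flipK D1Tel D1Rep D1Drift)
open Summit.QuantumFields.BalabanUV.Beta.TameKernelCalculus
open Summit.QuantumFields.BalabanUV.Beta.ChartConjugation (conjV conjW)
open Summit.QuantumFields.BalabanUV.Beta.ChartConjugationDefectEnd (conjDefect)
open Summit.QuantumFields.BalabanUV.Beta.AxialDressingRooted (one_le_of_neZero)
open Summit.QuantumFields.BalabanUV.Beta.SymmetrisedDressingKernel (coDressKSymAt)
open Summit.QuantumFields.BalabanUV.Beta.SymmetrisedDressingDress (dressSymAt)
open Summit.QuantumFields.BalabanUV.Beta.RowD1JointEndSymLetters (d1Drift_dressSymCtr_of_jetLetters_D1Tel_D1Rep)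
open Summit.QuantumFields.BalabanUV.Beta.SymmetrisedStepJets (SymTables JsB12Sym0 JsB12Sym JsB12Sym0_S_translate JsB12Sym0_W_translate)

namespace Summit.QuantumFields.BalabanUV.Beta.RowD1JointEndSym

noncomputable section

variable {Lc : ℕ} [NeZero Lc]

/-! ## §7 The D1-TRIGGER's named placeholder root, typed at the (0.4) literal over its table record -/

open B6BondElimination (unitVec) in
open KernelWard (divV divW) in
open Summit.QuantumFields.BalabanUV.Beta.BorderedHessian (sgnK bhKStep stepScale) in
open Summit.QuantumFields.BalabanUV.Beta.SymSliceProjectorKernel (symEc) in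
/-- **ROW D1 — THE PLACEHOLDER ROOT OF `beta/D1-TRIGGER.json`, TYPED**: `D1Drift Lc (JsB12Sym hLc N tabs cΛ cB) Nc μ ν` from EXACTLY the LETTERS of the
(0.4) literal's tables — (Sd)(Wd) Ward divergence laws against `bhKStep 3 Lc j` ∕ `symEc Lc` (localised data, parity-odd remainder), (Sr-conj)(Wr-conj-c)
conjugated reflection laws (contacts, compensators), `hcomp` — plus `D1Tel`, `D1Rep`, the printed B5 facts and the window; the translation letters (St)(Wt) are
THEOREMS (`SymmetrisedStepJets.JsB12Sym0_S∕W_translate`).  HONEST: statement + composition by name; 0∕5 root-level classes discharged; the table record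
`tabs` (an1's values) is displayed, not constructed. -/
theorem d1Drift_JsB12Sym_of_letters_D1Tel_D1Rep (hLc : Odd Lc) (hL2 : 2 ≤ Lc) (N : ℕ) (tabs : SymTables 3 Lc) (cΛ cB : ℝ)
    -- hW: the Ward divergence letters of the literal's tables against `bhKStep 3 Lc j` ∕ `symEc Lc` ((St)(Wt) are theorems)
    (Xw : ℕ → (Fin 4 → ℤ) → MKer 4 (Fib 3)) (hXw : ∀ j y, Loc (Xw j y)) (hEXw : ∀ j y, comp (symEc Lc) (Xw j y) = comp (Xw j y) (symEc Lc))
    (X₂w Nr : ℕ → (Fin 4 → ℤ) → Fin 4 → (Fin 4 → ℤ) → MKer 4 (Fib 3)) (hX₂w : ∀ j y ν y', Loc (X₂w j y ν y'))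
    (hNr : ∀ j y ν y', Loc (Nr j y ν y')) (hEX₂w : ∀ j y ν y', comp (symEc Lc) (X₂w j y ν y') = comp (X₂w j y ν y') (symEc Lc))
    (hSd : ∀ (j : ℕ) (y : Fin 4 → ℤ),
      (stepScale 3 Lc j * (Lc : ℝ) ^ (3 + 1))⁻¹ • ∑ v ∈ box 4 Lc, divV (JsB12Sym0 hLc N tabs cΛ cB j).S ((Lc : ℤ) • y + toSite v) = conjV (bhKStep 3 Lc j) (Xw j y))
    (hWd : ∀ (j : ℕ) (y : Fin 4 → ℤ) (ν : Fin 4) (y' : Fin 4 → ℤ),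
      divW (JsB12Sym0 hLc N tabs cΛ cB j).W y ν y' = conjW (bhKStep 3 Lc j) 0 (vertexOfK (coDressKSymAt (toSite (ctrOff 4 Lc)) Lc (KInvStep (d := 3) Lc j)) Lc (JsB12Sym0 hLc N tabs cΛ cB j).S ν y')
        (Xw j y) 0 (X₂w j y ν y') + Nr j y ν y')
    (hNt : ∀ j y ν y', trK (Nr j y ν y') = -sgnK (Nr j y ν y'))
    -- hR ∧ hSX: the compensated letters against `bhKStep 3 Lc j`
    (C : ℕ → Fin 4 → Fin 4 → (Fin 4 → ℤ) → MKer 4 (Fib 3)) (Cc δc : ℕ → ℝ) (hC : ∀ j α, LocStencil (C j α) (Cc j) (δc j))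
    (hδc : ∀ j, 0 < δc j) (X₂ Wc : ℕ → Fin 4 → Fin 4 → (Fin 4 → ℤ) → Fin 4 → (Fin 4 → ℤ) → MKer 4 (Fib 3))
    (hX₂ : ∀ j α μ y ν y', Loc (X₂ j α μ y ν y')) (hWc : ∀ j α μ y ν y', Loc (Wc j α μ y ν y'))
    (hSrC : ∀ (j : ℕ) (α κ' : Fin 4) (u : Fin 4 → ℤ),
      (JsB12Sym0 hLc N tabs cΛ cB j).S κ' (bref α κ' u) = reflSign α κ' • refK (Φ Lc α) ((JsB12Sym0 hLc N tabs cΛ cB j).S κ' u + conjV (bhKStep 3 Lc j) (C j α κ' u)))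
    (hWrC : ∀ (j : ℕ) (α μ : Fin 4) (y : Fin 4 → ℤ) (ν : Fin 4) (y' : Fin 4 → ℤ),
      (JsB12Sym0 hLc N tabs cΛ cB j).W μ (bref α μ y) ν (bref α ν y') = (reflSign α μ * reflSign α ν) • refK (Φ Lc α) ((JsB12Sym0 hLc N tabs cΛ cB j).W μ y ν y' +
        conjW (bhKStep 3 Lc j) (vertexOfK (coDressKSymAt (toSite (ctrOff 4 Lc)) Lc (KInvStep (d := 3) Lc j)) Lc (JsB12Sym0 hLc N tabs cΛ cB j).S μ y)
          (vertexOfK (coDressKSymAt (toSite (ctrOff 4 Lc)) Lc (KInvStep (d := 3) Lc j)) Lc (JsB12Sym0 hLc N tabs cΛ cB j).S ν y')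
          (vertexOfK (coDressKSymAt (toSite (ctrOff 4 Lc)) Lc (KInvStep (d := 3) Lc j)) Lc (C j α) μ y)
          (vertexOfK (coDressKSymAt (toSite (ctrOff 4 Lc)) Lc (KInvStep (d := 3) Lc j)) Lc (C j α) ν y') (X₂ j α μ y ν y')
          + Wc j α μ y ν y'))
    (hcomp : ∀ (j : ℕ) (α μ : Fin 4) (y : Fin 4 → ℤ) (ν : Fin 4) (y' : Fin 4 → ℤ),
      (1 / 2 : ℝ) * tadpole (coDressKSymAt (toSite (ctrOff 4 Lc)) Lc (KInvStep (d := 3) Lc j)) (Wc j α μ y ν y')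
        + conjDefect (coDressKSymAt (toSite (ctrOff 4 Lc)) Lc (KInvStep (d := 3) Lc j)) (bhKStep 3 Lc j)
            (vertexOfK (coDressKSymAt (toSite (ctrOff 4 Lc)) Lc (KInvStep (d := 3) Lc j)) Lc (JsB12Sym0 hLc N tabs cΛ cB j).S μ y)
            (vertexOfK (coDressKSymAt (toSite (ctrOff 4 Lc)) Lc (KInvStep (d := 3) Lc j)) Lc (JsB12Sym0 hLc N tabs cΛ cB j).S ν y')
            (vertexOfK (coDressKSymAt (toSite (ctrOff 4 Lc)) Lc (KInvStep (d := 3) Lc j)) Lc (C j α) μ y)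
            (vertexOfK (coDressKSymAt (toSite (ctrOff 4 Lc)) Lc (KInvStep (d := 3) Lc j)) Lc (C j α) ν y') (X₂ j α μ y ν y') = 0)
    -- the route theorem's own binders, verbatim
    (a : ℝ) (ha : 0 < a)
    (h12 : B5.Prop12Printed (fam (fun i : ℕ+ × ℕ => ((i.1 : ℕ+) : ℕ)) (fun i => i.1.pos) MvE a ha))
    (h126 : B5.Kernel126_127Printed (kfam (fun i : ℕ+ × ℕ => ((i.1 : ℕ+) : ℕ)) MvE))
    {L : Type*} {SL : Finset L} (hSL : SL.Nonempty) (k : L → Fin 4) {μ ν : Fin 4} (hμν : μ ≠ ν) {Nc : ℝ} (hNc : Nc ≠ 0)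
    (Jc : ∀ m : ℕ, JetData 3 (Lc ^ m))
    (htel : D1Tel Lc (JsB12Sym hLc N tabs cΛ cB) Jc)
    {cc : ℝ} {Mw' : ℕ → ℕ} (hc : 1 ≤ cc) (hMwin : ∀ L : ℕ, 2 ≤ L → 1 ≤ Mw' L ∧ (L : ℝ) ≤ cc * Mw' L) (hML : ∀ L : ℕ, 2 ≤ L → Mw' L ≤ L)
    (hrep : D1Rep Lc Jc Nc μ ν a SL k) :
    D1Drift Lc (JsB12Sym hLc N tabs cΛ cB) Nc μ ν :=
  d1Drift_dressSymCtr_of_jetLetters_D1Tel_D1Rep hLc hL2 (JsB12Sym0 hLc N tabs cΛ cB)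
    (JsB12Sym0_S_translate hLc N tabs cΛ cB) (JsB12Sym0_W_translate hLc N tabs cΛ cB)
    Xw hXw hEXw X₂w Nr hX₂w hNr hEX₂w hSd hWd hNt C Cc δc hC hδc X₂ Wc hX₂ hWc hSrC hWrC hcomp a ha h12 h126 hSL k hμν hNc Jc htel hc hMwin hML hrep

end

end Summit.QuantumFields.BalabanUV.Beta.RowD1JointEndSym
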